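import Summits.ResolutionOfSingularities.ResolutionOfSingularities.Theorems.KeyChainLU4
import HarnessLib

/-!
# KeyChainCut — decomp-res node «KeyLadder» (lens-1 g21), tree file 5/5: key-chain local uniformization

Content VERBATIM from the decomp-res lens-1 g21 tree companion `HOME/decomp-res-lens-1/g21/tree/KeyChainLU.lean`
(sha 0edd4007, 1 331 l; = the node
`g21/KeyLadder.lean` a1145436 re-namespaced, typed against the LANDED `Theorems.WCut`, nothing inlined; farm rc 0 ·
0 err · 0 warn · 0 sorry, axioms
standard; HOME = run/shared/lean/pub/decomp-res).  Critic: CRITIC-LEDGER row 163 (DECIDED +1 · MAP 0: the kernel law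
`relLU_of_keyChainTop`, cell
`KeyChainTopBelow`, exact cuts of both `W`-halves; 2026-08-31T01:02:09Z); landing orders INBOX :625 / :633,
`g21/WRITER.md` 82b559ef.  Landed by
decomp-res writer g9 for the lens-1 column (host route `Valuative`, item `LuAlphaPTorsor` stmt-…-0641 — HELPER
files, no route edit) as
`KeyChainLU` / `KeyChainLU2` / … (PARTS I–VI, greedy ≤ 400-line packing, linear imports) and `KeyChainCut` (PART
VII, the split point named in
WRITER.md); namespace, sections, section variables / opens and every declaration exactly as in the companion (its
one global linter option dropped;
the companion lemma `valuation_algebraMap_eq_one` restated the landed `Literature…ELU.valuation_algebraMap_eq_one` —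
gate `dedup.landed` p800231 —
so the copy is dropped and its two uses cite the Literature lemma, import `EmbeddedLocalUniformization` in file 2).

-/

noncomputable section

open IsLocalRing Literature.AlgebraicGeometry.Resolution
open Summit.ResolutionOfSingularities.ResolutionOfSingularities.Theorems

namespace Summit.ResolutionOfSingularities.ResolutionOfSingularities.Theorems.KeyChainLU

section Cut

open Summit.ResolutionOfSingularities.ResolutionOfSingularities.Theses
open Summit.ResolutionOfSingularities.ResolutionOfSingularities.Theorems.PfaffLine
open Summit.ResolutionOfSingularities.ResolutionOfSingularities.Theorems.ToricLadder
open Summit.ResolutionOfSingularities.ResolutionOfSingularities.Theorems.KaplanskyLadder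
open Summit.ResolutionOfSingularities.ResolutionOfSingularities.Theorems.PerronLadder
open Summit.ResolutionOfSingularities.ResolutionOfSingularities.Theorems.DefectlessLadder
open Summit.ResolutionOfSingularities.ResolutionOfSingularities.Theorems.WCut

/-! ## PART VII — the cut of the true residual and of its `W`-halves; ROOT BY NAME (§7) -/

/-- **DECIDED PIECE** (tag DECIDED — a kernel THEOREM, `nonKHToricArchLUKeyCell_holds`; WEAKER than
the root; located at `(e, c, n) = (3, 3, 4)`): the true residual family `NonKHToricArchLU e c n`
restricted to the cell `KeyChainTopBelow` (inductive binomial key chain over a monomial `3`-frame). -/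
def NonKHToricArchLUKeyCell (e c n : ℕ) : Prop :=
  ∀ p : ℕ, p.Prime → ∀ (k K : Type) [Field k] [CharP k p] [Field K] [Algebra k K],
    Algebra.trdeg k K ≤ n → ∀ O : ValuationSubring K, Nonempty O.valuation.RankOne →
    (∀ y ∈ O, ∃ f : Polynomial k, f ≠ 0 ∧ Polynomial.aeval y f ∈ O.nonunits) →
    ¬ IsAbhyankarPlace O (algebraMap k K).fieldRange ⊤ →
    ¬ (∃ d : ℕ, d < n ∧ SepDenseBelow k O d) → ¬ ToricDenseBelow k O e → ¬ KHTopBelow k O c →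
    KeyChainTopBelow k O → RelLocalUniformization k K O

/-- THE LAW DECIDES THE CELL PIECE outright, for all parameters (no port, no hypothesis). [folklore] -/
theorem nonKHToricArchLUKeyCell_holds (e c n : ℕ) : NonKHToricArchLUKeyCell e c n :=
  fun _ _ _ _ _ _ _ _ _ _ _ _ _ _ _ _ hkey => relLU_of_keyChainTop hkey

/-- **NEW LOCATED RESIDUAL** (tag UNDECIDED · WEAKER than the root · located at `(e, c, n) = (3, 3, 4)`):
the true residual family OFF the key-chain cell. -/
def NonKHToricArchLUKey (e c n : ℕ) : Prop :=
  ∀ p : ℕ, p.Prime → ∀ (k K : Type) [Field k] [CharP k p] [Field K] [Algebra k K],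
    Algebra.trdeg k K ≤ n → ∀ O : ValuationSubring K, Nonempty O.valuation.RankOne →
    (∀ y ∈ O, ∃ f : Polynomial k, f ≠ 0 ∧ Polynomial.aeval y f ∈ O.nonunits) →
    ¬ IsAbhyankarPlace O (algebraMap k K).fieldRange ⊤ →
    ¬ (∃ d : ℕ, d < n ∧ SepDenseBelow k O d) → ¬ ToricDenseBelow k O e → ¬ KHTopBelow k O c →
    ¬ KeyChainTopBelow k O → RelLocalUniformization k K O

/-- `nonKHToricArchLUKey_of_nonKHToric`: Auxiliary step of the key-chain calculus, VERBATIM from the lens-1 g21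
companion (see the module docstring); the statement is its type. [folklore] -/
theorem nonKHToricArchLUKey_of_nonKHToric {e c n : ℕ} (h : NonKHToricArchLU e c n) :
    NonKHToricArchLUKey e c n :=
  fun p hp k K _ _ _ _ hd O h1 h0 hA hnd hnt hnk _ => h p hp k K hd O h1 h0 hA hnd hnt hnk

/-- **THE KEY-CHAIN CUT** (kernel, exact): the true residual is EQUIVALENT to its part off the cell —
the part on the cell being the theorem `nonKHToricArchLUKeyCell_holds`. [folklore] -/
theorem nonKHToricArchLU_iff_key {e c n : ℕ} : NonKHToricArchLU e c n ↔ NonKHToricArchLUKey e c n := by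
  refine ⟨nonKHToricArchLUKey_of_nonKHToric, fun h p hp k K _ _ _ _ hd O hr hz hA hnd hnt hnk => ?_⟩
  by_cases hkey : KeyChainTopBelow k O
  · exact relLU_of_keyChainTop hkey
  · exact h p hp k K hd O hr hz hA hnd hnt hnk hkey

/-- The same cut written as a conjunction «decided cell piece ∧ new residual». [folklore] -/
theorem nonKHToricArchLU_iff_keyCell_and_key {e c n : ℕ} :
    NonKHToricArchLU e c n ↔ NonKHToricArchLUKeyCell e c n ∧ NonKHToricArchLUKey e c n :=
  ⟨fun h => ⟨nonKHToricArchLUKeyCell_holds e c n, nonKHToricArchLUKey_of_nonKHToric h⟩,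
    fun h => nonKHToricArchLU_iff_key.2 h.2⟩

/-- `W = 0` HALF OFF THE CELL (tag UNDECIDED · WEAKER than the root; the `W = 0` half of g20 with the
key-chain places removed — I3 is REMOVED: it lies in the cell, PART 0 §C). -/
def NonKHToricArchLUWZeroKey (e c n : ℕ) : Prop :=
  ∀ p : ℕ, p.Prime → ∀ (k K : Type) [Field k] [CharP k p] [Field K] [Algebra k K],
    Algebra.trdeg k K ≤ n → ∀ O : ValuationSubring K, Nonempty O.valuation.RankOne →
    (∀ y ∈ O, ∃ f : Polynomial k, f ≠ 0 ∧ Polynomial.aeval y f ∈ O.nonunits) →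
    ¬ IsAbhyankarPlace O (algebraMap k K).fieldRange ⊤ →
    ¬ (∃ d : ℕ, d < n ∧ SepDenseBelow k O d) → ¬ ToricDenseBelow k O e → ¬ KHTopBelow k O c →
    ¬ WNonzero k O → ¬ KeyChainTopBelow k O → RelLocalUniformization k K O

/-- `W ≠ 0` HALF OFF THE CELL (tag UNDECIDED · WEAKER than the root; the `W ≠ 0` half of g20 with the
key-chain places removed — I3_ℓ is REMOVED: it lies in the cell, PART 0 §C). -/
def NonKHToricArchLUWPosKey (e c n : ℕ) : Prop :=
  ∀ p : ℕ, p.Prime → ∀ (k K : Type) [Field k] [CharP k p] [Field K] [Algebra k K],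
    Algebra.trdeg k K ≤ n → ∀ O : ValuationSubring K, Nonempty O.valuation.RankOne →
    (∀ y ∈ O, ∃ f : Polynomial k, f ≠ 0 ∧ Polynomial.aeval y f ∈ O.nonunits) →
    ¬ IsAbhyankarPlace O (algebraMap k K).fieldRange ⊤ →
    ¬ (∃ d : ℕ, d < n ∧ SepDenseBelow k O d) → ¬ ToricDenseBelow k O e → ¬ KHTopBelow k O c →
    WNonzero k O → ¬ KeyChainTopBelow k O → RelLocalUniformization k K O

/-- EXACT RE-LOCATION of the `W = 0` half. [folklore] -/
theorem nonKHToricArchLUWZero_iff_key {e c n : ℕ} :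
    NonKHToricArchLUWZero e c n ↔ NonKHToricArchLUWZeroKey e c n := by
  refine ⟨fun h p hp k K _ _ _ _ hd O hr hz hA hnd hnt hnk hW _ =>
    h p hp k K hd O hr hz hA hnd hnt hnk hW, fun h p hp k K _ _ _ _ hd O hr hz hA hnd hnt hnk hW => ?_⟩
  by_cases hkey : KeyChainTopBelow k O
  · exact relLU_of_keyChainTop hkey
  · exact h p hp k K hd O hr hz hA hnd hnt hnk hW hkey

/-- EXACT RE-LOCATION of the `W ≠ 0` half. [folklore] -/
theorem nonKHToricArchLUWPos_iff_key {e c n : ℕ} :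
    NonKHToricArchLUWPos e c n ↔ NonKHToricArchLUWPosKey e c n := by
  refine ⟨fun h p hp k K _ _ _ _ hd O hr hz hA hnd hnt hnk hW _ =>
    h p hp k K hd O hr hz hA hnd hnt hnk hW, fun h p hp k K _ _ _ _ hd O hr hz hA hnd hnt hnk hW => ?_⟩
  by_cases hkey : KeyChainTopBelow k O
  · exact relLU_of_keyChainTop hkey
  · exact h p hp k K hd O hr hz hA hnd hnt hnk hW hkey

/-- The true residual as the conjunction of its two `W`-halves OFF THE CELL (W-cut ∘ key-chain cut). [folklore] -/
theorem nonKHToricArchLU_iff_wkey {e c n : ℕ} :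
    NonKHToricArchLU e c n ↔ NonKHToricArchLUWZeroKey e c n ∧ NonKHToricArchLUWPosKey e c n := by
  rw [nonKHToricArchLU_iff_wcut, nonKHToricArchLUWZero_iff_key, nonKHToricArchLUWPos_iff_key]

/-- The new residual follows from the root outright (it is a WEAKER piece). [folklore] -/
theorem nonKHToricArchLUKey_of_root (hS : _root_.ResolutionOfSingularities) (e c n : ℕ) :
    NonKHToricArchLUKey e c n :=
  nonKHToricArchLUKey_of_nonKHToric (nonKHToricArchLU_of_root hS e c n)

/-- Both `W`-halves off the cell follow from the root outright (WEAKER pieces). [folklore] -/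
theorem wkey_of_root (hS : _root_.ResolutionOfSingularities) (e c n : ℕ) :
    NonKHToricArchLUWZeroKey e c n ∧ NonKHToricArchLUWPosKey e c n :=
  nonKHToricArchLU_iff_wkey.1 (nonKHToricArchLU_of_root hS e c n)

/-- **`closes_key` — ROOT BY NAME (deciding theorem of this node).**  Cossart–Piltant floor (print) +
CJS-2020 (named fact, tree) + the KK05 (NC)+(V) ascent Π₁ (print) + the true residual OFF THE KEY-CHAIN
CELL in transcendence degree `≥ 4` + the patching crux 0642 ⇒ `ResolutionOfSingularities`; the cell
itself is discharged INSIDE the kernel by `relLU_of_keyChainTop`. [folklore] -/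
theorem closes_key (hCP : CossartPiltant2019LU3.{0}) (hCJS : CossartJannsenSaito2020Embedded.{0})
    (hAsc : KK05NCVAscent) (hN : ∀ d, 4 ≤ d → NonKHToricArchLUKey 3 3 d)
    (h₃ : Valuative.PatchingRel) : _root_.ResolutionOfSingularities :=
  closes_sigma hCP hCJS hAsc (fun d hd => nonKHToricArchLU_iff_key.2 (hN d hd)) h₃

/-- ROOT BY NAME, `W`-refined form: the two `W`-halves off the cell in place of the residual. [folklore] -/
theorem closes_wkey (hCP : CossartPiltant2019LU3.{0}) (hCJS : CossartJannsenSaito2020Embedded.{0})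
    (hAsc : KK05NCVAscent) (hW₀ : ∀ d, 4 ≤ d → NonKHToricArchLUWZeroKey 3 3 d)
    (hW₁ : ∀ d, 4 ≤ d → NonKHToricArchLUWPosKey 3 3 d) (h₃ : Valuative.PatchingRel) :
    _root_.ResolutionOfSingularities :=
  closes_sigma hCP hCJS hAsc (fun d hd => nonKHToricArchLU_iff_wkey.2 ⟨hW₀ d hd, hW₁ d hd⟩) h₃

/-- Root-level summary: modulo floor + CJS + Π₁ + 0642 the ROOT is EQUIVALENT to the residual family off
the key-chain cell (`root_iff_nonKHToric_sigma` transported along the exact cut). [folklore] -/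
theorem root_iff_key_sigma (hCP : CossartPiltant2019LU3.{0})
    (hCJS : CossartJannsenSaito2020Embedded.{0}) (hAsc : KK05NCVAscent) (h₃ : Valuative.PatchingRel) :
    _root_.ResolutionOfSingularities ↔ ∀ d, 4 ≤ d → NonKHToricArchLUKey 3 3 d := by
  rw [root_iff_nonKHToric_sigma hCP hCJS hAsc h₃]
  exact forall₂_congr fun d _ => nonKHToricArchLU_iff_key

end Cut

end Summit.ResolutionOfSingularities.ResolutionOfSingularities.Theorems.KeyChainLU
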